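import Literature.Computability.Cryptography.HallgrenClassGroupHowell
import HarnessLib

/-!
# The class-group stage: classical post-processing of the Fourier samples (definitions)

Topic `Computability/Cryptography`; DEFINITIONS ONLY. The post-processor of the class-group stage of the crux
`LinnikCubicClassGroups.PureCubicClassGroupFBQP` (line `arakelov-giant-step-cycle`): each oracle unit of the shift-sampling
experiment returns an outcome `c < Q`; a valid outcome decodes (`decodeUnit`) to a frequency slice with signed residue `kk`
(`|kk| ≤ K₀`) and a shifted digit-frequency `ν̃ < W = M^T` (`M = 2^ℓe`), whose digit angles `φ_t = −ν̃/M^{T−t}` approximate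
`ξ_t + kk·μ'_t (mod 1)` for a character `ξ ∈ Λ^*/ℤ^T` of the hidden lattice and an UNKNOWN coupling `μ'` (the Arakelov shift).
The PAIRING `ζ = kk₂ φ₁ − kk₁ φ₂` of two valid outcomes kills `μ'`; rounding each coordinate to the unique fraction of denominator
`≤ B` within `1/(2B²)` (`roundB`) recovers `kk₂ ξ₁ − kk₁ ξ₂ ∈ Λ^*/ℤ^T` EXACTLY; the rows `N ζ (mod N)` (`N` = lcm of the
denominators) are character coordinates, and the tree's subgroup-order algorithm (`Hallgren2005.Howell.subgroupOrderPure`,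
`SubgroupOrder.subgroupOrder_eq_card_closure`, `card_closure_charCoord_eq`) returns the order of the group they generate —
the subgroup order `h'` when they generate. [Hallgren 2005, §4; Kitaev 1995, §4; Cheung–Mosca 2001, §3]

* `PostParams` (T ℓe s aexp top K₀ B), `decodeUnit`, `phi`, `roundB`, `derive`, `pairRows`, `lcmDen`, `natRows`, `postOut`.

## References

* S. Hallgren, STOC 2005, §4. [Hallgren2005]
* A. Yu. Kitaev, arXiv:quant-ph/9511026 (1995), §4. [Kitaev1995]
* K. K. H. Cheung, M. Mosca, QIC 1 (2001), §3. [CheungMosca2001]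
-/

noncomputable section

namespace Literature.Computability.Cryptography

namespace CubicClassPost

/-- **Parameters of the post-processor**: `T` digits of `ℓe` bits, `S = 2^s` grid points per period, slice multiplier
`a = 2^aexp`, `top` = number of bits above the period block (coins + padding), `K₀` = half-width of the slice window,
`B` = denominator bound of the characters (a class-number bound). [cite: Hallgren2005, §4] -/
structure PostParams where
  /-- number of digit coordinates -/
  T : ℕ
  /-- bits per digit (`M = 2^ℓe`) -/
  ℓe : ℕ
  /-- `S = 2^s` -/
  s : ℕ
  /-- `a = 2^aexp` -/
  aexp : ℕ
  /-- bits above the period block -/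
  top : ℕ
  /-- slice window half-width -/
  K₀ : ℕ
  /-- denominator bound -/
  B : ℕ

/-- **Bounded-denominator rounding**: the unique fraction of denominator `≤ B` within `1/(2B²)` of `x` (else `0`).
[cite: Kitaev1995, §4] -/
def roundB (B : ℕ) (x : ℚ) : ℚ :=
  haveI := Classical.propDecidable (∃ r : ℚ, r.den ≤ B ∧ |x - r| < 1 / (2 * (B : ℚ) ^ 2))
  if h : ∃ r : ℚ, r.den ≤ B ∧ |x - r| < 1 / (2 * (B : ℚ) ^ 2) then Classical.choose h else 0

/-- The common denominator `N` = lcm of all denominators met (`≥ 1`). [folklore] -/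
def lcmDen (rows : List (List ℚ)) : ℕ := (rows.map fun row => (row.map Rat.den).foldl Nat.lcm 1).foldl Nat.lcm 1

/-- The rows as natural residues modulo `N`: `ζ ↦ (N ζ) mod N` (an integer since `den ζ ∣ N`). [cite: CheungMosca2001, §3] -/
def natRows (N : ℕ) (rows : List (List ℚ)) : List (List ℕ) :=
  rows.map fun row => row.map fun ζ : ℚ => ((ζ * (N : ℚ)).num % (N : ℤ)).toNat

namespace PostParams

variable (P : PostParams)

/-- `W = M^T = 2^(ℓe T)`. [folklore] -/
def W : ℕ := 2 ^ (P.ℓe * P.T)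

/-- **Decode one unit outcome** `c`: strip the top bits and the slice multiplier (divisibility checks), split `k' = c₁/a`
into `k₀ = k' mod S` and `ν = k'/S`, keep only the slice window (`k₀ ≤ K₀` or `k₀ ≥ S − K₀`), and return the signed residue
`kk` with the shifted frequency `ν̃ = ν + [kk < 0] (mod W)`. [cite: Hallgren2005, §4] -/
def decodeUnit (c : ℕ) : Option (ℤ × ℕ) :=
  if 2 ^ P.top ∣ c ∧ 2 ^ P.aexp ∣ c / 2 ^ P.top then
    (fun k' : ℕ =>
      if k' % 2 ^ P.s ≤ P.K₀ then some (((k' % 2 ^ P.s : ℕ) : ℤ), (k' / 2 ^ P.s) % P.W)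
      else if 2 ^ P.s - P.K₀ ≤ k' % 2 ^ P.s then some (((k' % 2 ^ P.s : ℕ) : ℤ) - (2 ^ P.s : ℕ), (k' / 2 ^ P.s + 1) % P.W)
      else none)
      (c / 2 ^ P.top / 2 ^ P.aexp)
  else none

/-- The digit angle `φ_t = −ν̃ / M^{T−t}` of coordinate `t < T`. [cite: Kitaev1995, §4] -/
def phi (ν : ℕ) (t : ℕ) : ℚ := -((ν : ℚ) / (2 : ℚ) ^ (P.ℓe * (P.T - t)))

/-- **The derived sample** of a pair of decoded outcomes: `ζ_t = roundB (fract (kk₂ φ₁,t − kk₁ φ₂,t))`. [cite: Hallgren2005, §4] -/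
def derive (u₁ u₂ : ℤ × ℕ) (t : ℕ) : ℚ :=
  roundB P.B (Int.fract ((u₂.1 : ℚ) * P.phi u₁.2 t - (u₁.1 : ℚ) * P.phi u₂.2 t))

/-- **Rows from the outcome list**: consecutive disjoint pairs `(c₀,c₁), (c₂,c₃), …` both of which decode give one derived
row `(ζ_0, …, ζ_{T−1})` each. [cite: Hallgren2005, §4] -/
def pairRows : List ℕ → List (List ℚ)
  | c₁ :: c₂ :: cs =>
    (match P.decodeUnit c₁, P.decodeUnit c₂ with
      | some u₁, some u₂ => [(List.range P.T).map (P.derive u₁ u₂)]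
      | _, _ => []) ++ pairRows cs
  | _ => []

/-- **The post-processor's output**: the order of the subgroup of `(ℤ/N)^T` generated by the derived rows
(`Hallgren2005.Howell.subgroupOrderPure`). [cite: CheungMosca2001, §3; Hallgren2005, §4] -/
def postOut (cs : List ℕ) : ℕ :=
  Hallgren2005.Howell.subgroupOrderPure (lcmDen (P.pairRows cs)) P.T (natRows (lcmDen (P.pairRows cs)) (P.pairRows cs))

/-! ### Reduced pairing coefficients

Dividing the pairing coefficients `(kk₂, −kk₁)` by `gcd(kk₁, kk₂)` (and using `(1, 0)` when `kk₁ = 0`) keeps `c₁ kk₁ + c₂ kk₂ = 0` — so the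
unknown coupling still cancels — and makes `gcd(c₁, c₂) = 1`, so that `c₁ ξ₁ + c₂ ξ₂` is EXACTLY uniform on the character group when `ξ₁, ξ₂` are
(independent, uniform): the derived samples then escape every proper subgroup with probability `≥ 1/2`, with no arithmetic condition on the `kk`'s. -/

/-- **Reduced pairing coefficients** `c = (kk₂, −kk₁)/gcd(kk₁,kk₂)` (`(1,0)` if `kk₁ = 0`): `c₁ kk₁ + c₂ kk₂ = 0`, `gcd(c₁,c₂) = 1`.
[cite: Hallgren2005, §4] -/
def coefs (u₁ u₂ : ℤ × ℕ) : ℤ × ℤ :=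
  if u₁.1 = 0 then (1, 0) else (u₂.1 / (Int.gcd u₁.1 u₂.1 : ℤ), -(u₁.1 / (Int.gcd u₁.1 u₂.1 : ℤ)))

/-- **The reduced derived sample** `ζ_t = roundB (fract (c₁ φ₁,t + c₂ φ₂,t))`. [cite: Hallgren2005, §4] -/
def deriveR (u₁ u₂ : ℤ × ℕ) (t : ℕ) : ℚ :=
  roundB P.B (Int.fract (((coefs u₁ u₂).1 : ℚ) * P.phi u₁.2 t + ((coefs u₁ u₂).2 : ℚ) * P.phi u₂.2 t))

/-- Rows from the outcome list with the reduced pairing. [cite: Hallgren2005, §4] -/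
def pairRowsR : List ℕ → List (List ℚ)
  | c₁ :: c₂ :: cs =>
    (match P.decodeUnit c₁, P.decodeUnit c₂ with
      | some u₁, some u₂ => [(List.range P.T).map (P.deriveR u₁ u₂)]
      | _, _ => []) ++ pairRowsR cs
  | _ => []

/-- **The post-processor's output (reduced pairing)**: the order of the subgroup of `(ℤ/N)^T` generated by the reduced derived rows.
[cite: CheungMosca2001, §3; Hallgren2005, §4] -/
def postOutR (cs : List ℕ) : ℕ :=
  Hallgren2005.Howell.subgroupOrderPure (lcmDen (P.pairRowsR cs)) P.T (natRows (lcmDen (P.pairRowsR cs)) (P.pairRowsR cs))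

end PostParams

end CubicClassPost

end Literature.Computability.Cryptography
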